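import Summits.CriticalPhenomena.PercolationContinuityZ3.Theorems.PercNearOneGluingNoHeavyLowerTailQ44SingleSourceBaseSchemes

/-!
# The exit kernel `K♭` of a `K4s`-side: no `ab`-member contains it, and families with one `K4s`-container are certified

Support file for crux `stmt-CriticalPhenomena-4575` (master-family programme, row `Q44`, single-source packing
`g ≥ b1 + h_a`), seat `prim-bnk-1` gen 29; memo `run/shared/lean/prim/prim-l12/FROM-prim-bnk-1-gen29-BASE-SCHEMES.md` §2 (F8).

Let `(M, C)` be a graph fibre with marked points `a b c y` and `W₀ ⊆ M` a side of co-cell `a|b|cy` (a `K4s`-side: `a` is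
isolated from the other marked points in `C ∪ (M \ W₀)`).  Write `R v` for "`v` is reachable from `a` in `C ∪ (M \ W₀)`".
The EXIT KERNEL of `W₀` is

  `K♭ = {e ∈ W₀ : e = s(u,v) with R u, ¬ R v, v ≠ b}`

(the edges leaving the `a`-region other than into `b`; they all lie in `W₀`).

* `reachable_b_of_supset_exitKernel` — **the exit lemma**: if `X ⊆ M` contains every such edge and `a` reaches, in
  `C ∪ (M \ X)`, some vertex `t` with `¬ R t`, then `a` reaches `b` in `C ∪ (M \ X)` (walk induction: the first edge of the
  walk leaving the `a`-region is an `M \ X`-edge of `W₀`, hence ends at `b`).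
* `not_supset_exitKernel` — hence NO side whose co-cell joins `a` to `y` or to `c` but not to `b` (types
  `K1[ab|cy] (11,9)`, `K2[ab|cy] (11,8)`, `K4[ab] (6,8)`) contains `K♭`.
* `exists_odd_good_of_exitKernel` — for families of the types `K1, K2, K4, K5, K4s`: if a set `K ⊆ W₀` of cell `⊥`
  contains the exit kernel and the members of co-cell `a|b|cy` (`K5`, `K4s`) containing `K` are odd in number, there is an
  odd target (the `ab`-members never contain `K`; validity is `exists_odd_good_of_sub_K4s`).
* `exists_odd_good_of_unique_K4s_supset` — in particular, if `W₀` is the ONLY member of co-cell `a|b|cy` containing `K`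
  (e.g. the family has a single `K4s`-member and no `K5`-member), the family has an odd target.  This settles every
  CORE-A family with exactly one `K4s`-member whose exit kernel has cell `⊥` (all of > 1.8·10⁶ tested; memo F8).

No sorries, no definitions, standard axioms.
-/

namespace Summit.CriticalPhenomena.PercolationContinuityZ3.Theorems

namespace TwoCopyMono

open Finset FourPointAtoms KernelPeeling Literature.Probability.Percolation

variable {n : ℕ}

/-! ## The exit lemma -/

/-- **Exit lemma.**  `R` = reachability from `a` in `C ∪ (M \ W₀)`.  If `X` contains every edge `s(u,v) ∈ W₀` with
`R u`, `¬ R v`, `v ≠ b`, and in `C ∪ (M \ X)` the point `a` reaches a vertex outside the `R`-region, then `a` reaches `b`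
in `C ∪ (M \ X)`. [this work] -/
theorem reachable_b_of_supset_exitKernel (C M W₀ X : Finset (Sym2 (Fin n))) (a b t : Fin n)
    (hK : ∀ u v : Fin n, s(u, v) ∈ W₀ →
      (openGraph (↑(C ∪ (M \ W₀)) : Set (Sym2 (Fin n)))).Reachable a u →
      ¬ (openGraph (↑(C ∪ (M \ W₀)) : Set (Sym2 (Fin n)))).Reachable a v → v ≠ b → s(u, v) ∈ X)
    (ht : ¬ (openGraph (↑(C ∪ (M \ W₀)) : Set (Sym2 (Fin n)))).Reachable a t)
    (hreach : (openGraph (↑(C ∪ (M \ X)) : Set (Sym2 (Fin n)))).Reachable a t) :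
    (openGraph (↑(C ∪ (M \ X)) : Set (Sym2 (Fin n)))).Reachable a b := by
  set G₀ := openGraph (↑(C ∪ (M \ W₀)) : Set (Sym2 (Fin n))) with hG₀
  set G' := openGraph (↑(C ∪ (M \ X)) : Set (Sym2 (Fin n))) with hG'
  -- walk induction with the invariant: the current vertex is in the `R`-region and reachable from `a` in `G'`
  suffices h : ∀ (u t' : Fin n) (p : G'.Walk u t'), ¬ G₀.Reachable a t' → G₀.Reachable a u → G'.Reachable a u →
      G'.Reachable a b by
    obtain ⟨p⟩ := hreach
    exact h a t p ht (SimpleGraph.Reachable.refl _) (SimpleGraph.Reachable.refl _)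
  intro u t' p
  induction p with
  | nil => intro ht' hu _; exact absurd hu ht'
  | @cons u v w hadj p ih =>
    intro ht' hu hau
    have hav : G'.Reachable a v := hau.trans hadj.reachable
    by_cases hv : G₀.Reachable a v
    · exact ih ht' hv hav
    · -- the edge `s(u,v)` leaves the `R`-region
      have hadj' := hadj
      rw [hG', openGraph_coe_adj] at hadj'
      obtain ⟨huv, hne⟩ := hadj'
      -- it is not an edge of `C ∪ (M \ W₀)` (else `v` would be in the region)
      have hnot : s(u, v) ∉ C ∪ (M \ W₀) := by
        intro hmem
        apply hv
        have hadj₀ : G₀.Adj u v := by rw [hG₀, openGraph_coe_adj]; exact ⟨hmem, hne⟩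
        exact hu.trans hadj₀.reachable
      -- so it lies in `M \ X` and in `W₀`
      rcases Finset.mem_union.1 huv with hC | hMX
      · exact absurd (Finset.mem_union_left _ hC) hnot
      · rw [Finset.mem_sdiff] at hMX
        have hW₀ : s(u, v) ∈ W₀ := by
          by_contra hW
          exact hnot (Finset.mem_union_right _ (Finset.mem_sdiff.2 ⟨hMX.1, hW⟩))
        -- if `v ≠ b` the edge would be in `K♭ ⊆ X`
        by_cases hvb : v = b
        · rw [hvb] at hav; exact hav
        · exact absurd (hK u v hW₀ hu hv hvb) hMX.2

/-! ## No `ab`-member contains the exit kernel -/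

/-- **`K1/K2/K4`-sides do not contain the exit kernel of a `K4s`-side.**  Graph fibre with labelling `ι`; `W₀` with
`ι (M \ W₀) = a|b|cy`; `X ⊆ M` with co-cell `ι (M \ X) ∈ {ay|bc, ac|by}`.  Then `X` misses some edge of the exit kernel of
`W₀`. [this work] -/
theorem not_supset_exitKernel (a b c y : Fin n) (C M : Finset (Sym2 (Fin n)))
    (ι : Finset (Sym2 (Fin n)) → Fin 15) (hι : ∀ T : Finset (Sym2 (Fin n)), prof a b c y ↑(C ∪ T) = pp (ι T))
    (W₀ : Finset (Sym2 (Fin n))) (hW₀c : ι (M \ W₀) = 1)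
    (X : Finset (Sym2 (Fin n))) (hXc : ι (M \ X) = 8 ∨ ι (M \ X) = 9) :
    ¬ ∀ u v : Fin n, s(u, v) ∈ W₀ →
      (openGraph (↑(C ∪ (M \ W₀)) : Set (Sym2 (Fin n)))).Reachable a u →
      ¬ (openGraph (↑(C ∪ (M \ W₀)) : Set (Sym2 (Fin n)))).Reachable a v → v ≠ b → s(u, v) ∈ X := by
  intro hK
  have hq0 : quad a b c y 0 = a := rfl
  have hq1 : quad a b c y 1 = b := rfl
  have hq2 : quad a b c y 2 = c := rfl
  have hq3 : quad a b c y 3 = y := rfl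
  have hreach := reachable_iff_pp a b c y C ι hι
  -- `a ≁ b` in `C ∪ (M \ X)`
  have hab : ¬ (openGraph (↑(C ∪ (M \ X)) : Set (Sym2 (Fin n)))).Reachable a b := by
    intro h
    have h' := (hreach (M \ X) 0 1).1 (by rw [hq0, hq1]; exact h)
    rcases hXc with hc | hc <;> rw [hc] at h' <;> exact absurd h' (by decide)
  apply hab
  rcases hXc with hc | hc
  · -- co-cell `ay|bc`: `a ~ y` in the complement, `y` outside the region
    have hay : (openGraph (↑(C ∪ (M \ X)) : Set (Sym2 (Fin n)))).Reachable a y := by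
      have h := (hreach (M \ X) 0 3).2 (by rw [hc]; decide); rwa [hq0, hq3] at h
    have hy : ¬ (openGraph (↑(C ∪ (M \ W₀)) : Set (Sym2 (Fin n)))).Reachable a y := by
      intro h
      have h' := (hreach (M \ W₀) 0 3).1 (by rw [hq0, hq3]; exact h)
      rw [hW₀c] at h'; exact absurd h' (by decide)
    exact reachable_b_of_supset_exitKernel C M W₀ X a b y hK hy hay
  · -- co-cell `ac|by`: `a ~ c` in the complement, `c` outside the region
    have hac : (openGraph (↑(C ∪ (M \ X)) : Set (Sym2 (Fin n)))).Reachable a c := by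
      have h := (hreach (M \ X) 0 2).2 (by rw [hc]; decide); rwa [hq0, hq2] at h
    have hc' : ¬ (openGraph (↑(C ∪ (M \ W₀)) : Set (Sym2 (Fin n)))).Reachable a c := by
      intro h
      have h' := (hreach (M \ W₀) 0 2).1 (by rw [hq0, hq2]; exact h)
      rw [hW₀c] at h'; exact absurd h' (by decide)
    exact reachable_b_of_supset_exitKernel C M W₀ X a b c hK hc' hac

/-! ## Certificates from the exit kernel -/

/-- Table: the five types `K1[ab|cy], K2[ab|cy], K4[ab], K5[ab], K4s[ay|bc]` are among the six non-`Pc` single-source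
types, and those of co-cell `≠ a|b|cy` have co-cell `ay|bc` or `ac|by`. [this work] -/
theorem exitKernel_types :
    (∀ q ∈ ({(11, 9), (11, 8), (6, 8), (6, 1), (8, 1)} : Finset (Fin 15 × Fin 15)),
        q ∈ ({(6, 7), (11, 9), (11, 8), (6, 8), (6, 1), (8, 1)} : Finset (Fin 15 × Fin 15))) ∧
    (∀ q ∈ ({(11, 9), (11, 8), (6, 8), (6, 1), (8, 1)} : Finset (Fin 15 × Fin 15)),
        q.2 ≠ 1 → q.2 = 8 ∨ q.2 = 9) := by
  refine ⟨?_, ?_⟩ <;> decide +kernel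

/-- **Odd targets from the exit kernel.**  Graph fibre; `𝒮` a family of sides of types `K1, K2, K4, K5, K4s`; `W₀ ∈ 𝒮`
with co-cell `a|b|cy`; `K ⊆ W₀` of cell `⊥` containing every exit edge of `W₀` (`s(u,v) ∈ W₀`, `u` in the `a`-region of
`C ∪ (M \ W₀)`, `v` outside it and `≠ b`).  If the members of co-cell `a|b|cy` containing `K` are odd in number, some fat
good contains an odd number of members. [this work] -/
theorem exists_odd_good_of_exitKernel (a b c y : Fin n) (C M : Finset (Sym2 (Fin n)))
    (ι : Finset (Sym2 (Fin n)) → Fin 15) (hι : ∀ T : Finset (Sym2 (Fin n)), prof a b c y ↑(C ∪ T) = pp (ι T))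
    (𝒮 : Finset (Finset (Sym2 (Fin n)))) (h𝒮M : ∀ S ∈ 𝒮, S ⊆ M)
    (htypes : ∀ S ∈ 𝒮, (ι S, ι (M \ S)) ∈ ({(11, 9), (11, 8), (6, 8), (6, 1), (8, 1)} : Finset (Fin 15 × Fin 15)))
    (W₀ : Finset (Sym2 (Fin n))) (hW₀ : W₀ ∈ 𝒮) (hW₀c : ι (M \ W₀) = 1)
    (K : Finset (Sym2 (Fin n))) (hKW : K ⊆ W₀) (hK0 : ι K = 0)
    (hKexit : ∀ u v : Fin n, s(u, v) ∈ W₀ →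
      (openGraph (↑(C ∪ (M \ W₀)) : Set (Sym2 (Fin n)))).Reachable a u →
      ¬ (openGraph (↑(C ∪ (M \ W₀)) : Set (Sym2 (Fin n)))).Reachable a v → v ≠ b → s(u, v) ∈ K)
    (hodd : Odd #(𝒮.filter (fun S => K ⊆ S ∧ ι (M \ S) = 1))) :
    ∃ T ∈ goods (fun T : Finset (Sym2 (Fin n)) => ι (T ∩ M)), Odd #(𝒮.filter (fun S => S ⊆ T)) := by
  classical
  -- members containing `K` have co-cell `a|b|cy`
  have hEq : 𝒮.filter (fun S => K ⊆ S) = 𝒮.filter (fun S => K ⊆ S ∧ ι (M \ S) = 1) := by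
    refine Finset.filter_congr fun S hS => ⟨fun hKS => ⟨hKS, ?_⟩, fun h => h.1⟩
    by_contra h1
    have h89 := exitKernel_types.2 (ι S, ι (M \ S)) (htypes S hS) h1
    exact not_supset_exitKernel a b c y C M ι hι W₀ hW₀c S h89
      (fun u v hW hu hv hvb => hKS (hKexit u v hW hu hv hvb))
  have hodd' : Odd #(𝒮.filter (fun S => K ⊆ S)) := by rw [hEq]; exact hodd
  exact exists_odd_good_of_sub_K4s a b c y C M ι hι 𝒮 h𝒮M
    (fun S hS => exitKernel_types.1 _ (htypes S hS)) W₀ (h𝒮M W₀ hW₀) hW₀c K hKW hK0 hodd'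

/-- **A unique `K4s`-container certifies.**  As above, but assuming that `W₀` is the only member of co-cell `a|b|cy`
containing `K` — in particular when `W₀` is the only `K4s`-member and there is no `K5`-member.  Then some fat good
contains an odd number of members: every CORE-A family with a single `K4s`-side whose exit kernel has cell `⊥` is
certified. [this work] -/
theorem exists_odd_good_of_unique_K4s_supset (a b c y : Fin n) (C M : Finset (Sym2 (Fin n)))
    (ι : Finset (Sym2 (Fin n)) → Fin 15) (hι : ∀ T : Finset (Sym2 (Fin n)), prof a b c y ↑(C ∪ T) = pp (ι T))
    (𝒮 : Finset (Finset (Sym2 (Fin n)))) (h𝒮M : ∀ S ∈ 𝒮, S ⊆ M)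
    (htypes : ∀ S ∈ 𝒮, (ι S, ι (M \ S)) ∈ ({(11, 9), (11, 8), (6, 8), (6, 1), (8, 1)} : Finset (Fin 15 × Fin 15)))
    (W₀ : Finset (Sym2 (Fin n))) (hW₀ : W₀ ∈ 𝒮) (hW₀c : ι (M \ W₀) = 1)
    (K : Finset (Sym2 (Fin n))) (hKW : K ⊆ W₀) (hK0 : ι K = 0)
    (hKexit : ∀ u v : Fin n, s(u, v) ∈ W₀ →
      (openGraph (↑(C ∪ (M \ W₀)) : Set (Sym2 (Fin n)))).Reachable a u →
      ¬ (openGraph (↑(C ∪ (M \ W₀)) : Set (Sym2 (Fin n)))).Reachable a v → v ≠ b → s(u, v) ∈ K)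
    (huniq : ∀ S ∈ 𝒮, K ⊆ S → ι (M \ S) = 1 → S = W₀) :
    ∃ T ∈ goods (fun T : Finset (Sym2 (Fin n)) => ι (T ∩ M)), Odd #(𝒮.filter (fun S => S ⊆ T)) := by
  classical
  refine exists_odd_good_of_exitKernel a b c y C M ι hι 𝒮 h𝒮M htypes W₀ hW₀ hW₀c K hKW hK0 hKexit ?_
  have hEq : 𝒮.filter (fun S => K ⊆ S ∧ ι (M \ S) = 1) = {W₀} := by
    ext S
    simp only [Finset.mem_filter, Finset.mem_singleton]
    constructor
    · rintro ⟨hS, hKS, h1⟩; exact huniq S hS hKS h1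
    · rintro rfl; exact ⟨hW₀, hKW, hW₀c⟩
  rw [hEq, Finset.card_singleton]; exact odd_one

end TwoCopyMono

end Summit.CriticalPhenomena.PercolationContinuityZ3.Theorems
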